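import Summits.ABC.ABC.Theorems.ModerateWindowCount.Negative.SixSharpCore

/-!
# `ModerateWindowCount` (stmt-ABC-1973) — negative-side lemmas V: **`6 < σ` is sharp**

Standing-adversary (cdisprove) output. `not_windowLaw_le_six`: for `3 < κ < σ ≤ 6` no `δ < (6−κ)/6` and no
`C` give `T_[κ,σ](X) ≤ C X^δ` for all `X ≥ 1`; hence `not_moderateWindowLawAtSix`: at `σ = 6` the conclusion of
the crux (`∃ κ ∈ (3,6) ∃ δ < (6−κ)/6 ∃ C ∀ X ≥ 1, T_[κ,6](X) ≤ C X^δ`) is FALSE — for EVERY `κ, δ, C`;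
corollaries `not_moderateWindowCountFromSix` (`6 ≤ σ` version false), `moderateWindowCount_false_without_sixLtSigma`
(hypothesis dropped ⇒ false), `no_windowSaving_le_six` / `someWindowSaving_sigma_gt_six` (the sibling crux
`SomeWindowSaving` needs `σ > 6`) and the tightness floor `T_not_bigO_below_law` (`κ < 6`, any `σ > κ`,
`δ < 1 − κ/6` ⇒ not `O(X^δ)`). Proof: normalise `0 ≤ δ`, `1 ≤ C`; `sixSharp_exponents` gives `j = 4i`;
Chebyshev (`primesIoc_card_mul_log_ge`) gives `T₀`; `x^a, x^b → ∞` and `log² x = o(x^a)`, `log x = o(x^γ)`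
give the largeness conditions eventually; a prime `p ≥ max(x₀, 3)` exists; `sixSharp_core` concludes.
This is the route's twist amplification run on the unconditional quality-≥-1 triples `1 + (p^j − 1) = p^j`:
Szpiro's `6` is attained in the counting sense (counting form of
`Literature.Barriers.ABC.SzpiroEpsilonCannotBeDropped`), and the route's threshold `(σ−κ)/(2σ−6)` is attained
at `σ = 6`. Refuter seat refuter-cdisprove-stmt-ABC-1973-0, 2026-08-16.
-/

namespace Summit.ABC.ABC.Theorems.ModerateWindowCount.Negative

open Summit.ABC.ABC.Theses.TwistAmplification WeierstrassCurve IsDedekindDomain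
open Summit.ABC.ABC.Theorems.SomeWindowSaving.Negative

noncomputable section

/-! ### 4.5 `6 < σ` is sharp: the conclusion fails at `σ = 6`; corollaries -/

/-- The conclusion of `ModerateWindowCount` at the excluded endpoint `σ = 6`. -/
def ModerateWindowLawAtSix : Prop :=
  ∃ κ δ C : ℝ, 3 < κ ∧ κ < 6 ∧ δ < (6 - κ) / (2 * 6 - 6) ∧
    ∀ X : ℝ, 1 ≤ X → (windowCount κ 6 X : ℝ) ≤ C * X ^ δ

/-- **No window law below the conjectural exponent inside `(3, 6]`.** For `3 < κ < σ ≤ 6`, every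
`δ < (6−κ)/6 = 1 − κ/6` and every constant, `T_[κ,σ](X) ≤ C X^δ` fails for some `X ≥ 1` (twist
amplification on the quality-`≥ 1` triples `1 + (p^j − 1) = p^j`; see `sixSharp_core`). [folklore] -/
theorem not_windowLaw_le_six {κ σ δ₀ C₀ : ℝ} (hκ3 : 3 < κ) (hκσ : κ < σ) (hσ6 : σ ≤ 6)
    (hδ₀ : δ₀ < (6 - κ) / 6) : ¬ ∀ X : ℝ, 1 ≤ X → (windowCount κ σ X : ℝ) ≤ C₀ * X ^ δ₀ := by
  intro hlaw₀
  -- normalise: `0 ≤ δ < (6-κ)/6`, `1 ≤ C`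
  set δ : ℝ := max δ₀ 0 with hδdef
  have hδ0 : 0 ≤ δ := le_max_right _ _
  have hδ : δ < (6 - κ) / 6 := max_lt hδ₀ (div_pos (by linarith) (by norm_num))
  set C : ℝ := max C₀ 1 with hCdef
  have hC1 : 1 ≤ C := le_max_right _ _
  have hC0 : 0 < C := by linarith
  have hlaw : ∀ X : ℝ, 1 ≤ X → (windowCount κ σ X : ℝ) ≤ C * X ^ δ := by
    intro X hX
    refine (hlaw₀ X hX).trans ?_
    have hXδ : X ^ δ₀ ≤ X ^ δ := Real.rpow_le_rpow_of_exponent_le hX (le_max_left _ _)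
    have h0 : 0 ≤ X ^ δ₀ := Real.rpow_nonneg (by linarith) _
    calc C₀ * X ^ δ₀ ≤ C * X ^ δ₀ := mul_le_mul_of_nonneg_right (le_max_left _ _) h0
      _ ≤ C * X ^ δ := mul_le_mul_of_nonneg_left hXδ (by linarith)
  have h26 : 0 < 2 * κ - 6 := by linarith
  have h2σ : 0 < 2 * σ - 6 := by linarith
  -- exponents
  obtain ⟨i, hi1, hnum, hγ⟩ := sixSharp_exponents hκ3 hδ0 hδ
  set j : ℕ := 4 * i with hjdef
  have hj4 : (4 : ℝ) ≤ j := by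
    rw [hjdef]; push_cast
    have : (1 : ℝ) ≤ i := by exact_mod_cast hi1
    linarith
  have hj0 : j ≠ 0 := by intro h; rw [h] at hj4; norm_num at hj4
  set a : ℝ := (6 * j - κ * ((j : ℝ) + 1)) / (2 * κ - 6) with hadef
  set a' : ℝ := 6 * (j : ℝ) / (2 * κ - 6) with ha'def
  set b : ℝ := 6 * (σ - κ) * ((j : ℝ) - 1) / ((2 * κ - 6) * (2 * σ - 6)) with hbdef
  set c₀ : ℝ := Real.log 8 / (2 * κ - 6) with hc₀def
  set γ : ℝ := a * (1 - 2 * δ) - ((j : ℝ) + 1) * δ with hγdef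
  have ha : 0 < a := by rw [hadef]; exact div_pos hnum h26
  have ha' : 0 < a' := by rw [ha'def]; exact div_pos (by positivity) h26
  have hb : 0 < b := by
    rw [hbdef]; exact div_pos (mul_pos (mul_pos (by norm_num) (by linarith)) (by linarith)) (mul_pos h26 h2σ)
  -- prime supply threshold and largeness conditions
  obtain ⟨T₀, hT₀⟩ := primesIoc_card_mul_log_ge
  set K₁ : ℝ := 2 * ((max T₀ 64 : ℕ) : ℝ) * Real.exp c₀ with hK₁
  set K₂ : ℝ := 12 * Real.exp c₀ with hK₂
  set K₃ : ℝ := 48 * a' * j * Real.exp c₀ with hK₃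
  set K₄ : ℝ := 32 * C * a' * Real.exp c₀ with hK₄
  have hK₃0 : 0 < K₃ := by rw [hK₃]; positivity
  have hK₄0 : 0 < K₄ := by
    rw [hK₄]; exact mul_pos (mul_pos (mul_pos (by norm_num) hC0) ha') (Real.exp_pos _)
  have hev : ∀ᶠ x : ℝ in Filter.atTop, 1 ≤ x ∧ K₁ ≤ x ^ a ∧ K₂ ≤ x ^ b ∧
      K₃ * (Real.log x) ^ 2 ≤ x ^ a ∧ K₄ * Real.log x ≤ x ^ γ := by
    refine (Filter.eventually_ge_atTop 1).and ?_
    refine ((tendsto_rpow_atTop ha).eventually_ge_atTop K₁).and ?_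
    refine ((tendsto_rpow_atTop hb).eventually_ge_atTop K₂).and ?_
    refine (((isLittleO_log_rpow_rpow_atTop 2 ha).bound (inv_pos.mpr hK₃0)).mp ?_).and ?_
    · filter_upwards [Filter.eventually_ge_atTop (1 : ℝ)] with x hx h
      have hlx : 0 ≤ Real.log x := Real.log_nonneg hx
      rw [Real.norm_eq_abs, Real.norm_eq_abs, Real.rpow_two, abs_of_nonneg (by positivity),
        abs_of_nonneg (Real.rpow_nonneg (by linarith) _)] at h
      have := mul_le_mul_of_nonneg_left h hK₃0.le
      rwa [← mul_assoc, mul_inv_cancel₀ hK₃0.ne', one_mul] at this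
    · refine ((isLittleO_log_rpow_atTop hγ).bound (inv_pos.mpr hK₄0)).mp ?_
      filter_upwards [Filter.eventually_ge_atTop (1 : ℝ)] with x hx h
      have hlx : 0 ≤ Real.log x := Real.log_nonneg hx
      rw [Real.norm_eq_abs, Real.norm_eq_abs, abs_of_nonneg hlx,
        abs_of_nonneg (Real.rpow_nonneg (by linarith) _)] at h
      have := mul_le_mul_of_nonneg_left h hK₄0.le
      rwa [← mul_assoc, mul_inv_cancel₀ hK₄0.ne', one_mul] at this
  obtain ⟨x₀, hx₀⟩ := Filter.eventually_atTop.mp hev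
  obtain ⟨p, hpx, hp⟩ := Nat.exists_infinite_primes (max ⌈x₀⌉₊ 3)
  have hp3 : 3 ≤ p := le_of_max_le_right hpx
  have hpR : x₀ ≤ (p : ℝ) := (Nat.le_ceil x₀).trans (by exact_mod_cast le_of_max_le_left hpx)
  obtain ⟨-, hE1, hE2, hE3, hE4⟩ := hx₀ p hpR
  have hp2 : p % 2 = 1 := Nat.odd_iff.mp (hp.odd_of_ne_two (by omega))
  have hq16 : p ^ j % 16 = 1 := by rw [hjdef]; exact pow_four_mul_mod_sixteen hp2 i
  rw [hK₁] at hE1; rw [hK₂] at hE2; rw [hK₃] at hE3; rw [hK₄] at hE4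
  exact sixSharp_core hκ3 hκσ hσ6 hδ0 hδ hC1 hlaw hj0 hj4 hnum hT₀ hp hp3 hq16 hE1 hE2 hE3 hE4


/-- **MAIN NEGATIVE THEOREM.** At `σ = 6` the window law fails for every `κ ∈ (3,6)`, every
`δ < (6−κ)/6` and every constant: the hypothesis `6 < σ` of `ModerateWindowCount` is sharp. [folklore] -/
theorem not_moderateWindowLawAtSix : ¬ ModerateWindowLawAtSix := by
  rintro ⟨κ, δ, C, hκ3, hκ6, hδ, hlaw⟩
  have e : (6 - κ) / (2 * 6 - 6) = (6 - κ) / 6 := by norm_num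
  rw [e] at hδ
  exact not_windowLaw_le_six hκ3 hκ6 le_rfl hδ hlaw

/-- **No saving at all inside `(3, 6]`**: for `3 < κ < σ ≤ 6` the amplification threshold
`(σ−κ)/(2σ−6)` is `≤ (6−κ)/6` (`(6−κ)(2σ−6) − 6(σ−κ) = 2(6−σ)(κ−3) ≥ 0`), so NO `δ` below it works:
a witness of the sibling crux `SomeWindowSaving` must have `σ > 6` (`someWindowSaving_sigma_gt_six`). [folklore] -/
theorem no_windowSaving_le_six {κ σ δ C : ℝ} (hκ3 : 3 < κ) (hκσ : κ < σ) (hσ6 : σ ≤ 6)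
    (hδ : δ < (σ - κ) / (2 * σ - 6)) : ¬ ∀ X : ℝ, 1 ≤ X → (windowCount κ σ X : ℝ) ≤ C * X ^ δ := by
  refine not_windowLaw_le_six hκ3 hκσ hσ6 (hδ.trans_le ?_)
  rw [div_le_div_iff₀ (by linarith) (by norm_num)]
  nlinarith

/-- The sibling crux `SomeWindowSaving` (stmt-ABC-1976) can only be witnessed with `σ > 6`. [folklore] -/
theorem someWindowSaving_sigma_gt_six (h : SomeWindowSaving) :
    ∃ κ σ δ C : ℝ, 3 < κ ∧ κ < σ ∧ 6 < σ ∧ δ < (σ - κ) / (2 * σ - 6) ∧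
      ∀ X : ℝ, 1 ≤ X → (windowCount κ σ X : ℝ) ≤ C * X ^ δ := by
  obtain ⟨κ, σ, δ, C, hκ3, hκσ, hδ, hlaw⟩ := h
  refine ⟨κ, σ, δ, C, hκ3, hκσ, ?_, hδ, hlaw⟩
  by_contra hσ
  push Not at hσ
  exact no_windowSaving_le_six hκ3 hκσ hσ hδ hlaw

/-- **Exponent floor for the crux (tightness).** For every `κ ∈ (3,6)`, every `σ > κ` and every
`δ < (6−κ)/6 = 1 − κ/6`, NO constant makes `T_[κ,σ](X) ≤ C X^δ` hold for all `X ≥ 1` (for `σ ≤ 6` by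
`not_windowLaw_le_six`; for `σ ≥ 6` windows grow with `σ`). Hence in `ModerateWindowCount` a witness
`(κ, δ)` with `κ < 6` is confined to the strip `1 − κ/6 ≤ δ < (σ−κ)/(2σ−6)`, of width
`(κ−3)(σ−6)/(3(2σ−6))` (the route's margin identity): the conjectural law `X^{1−κ/6}` is an
unconditional FLOOR for the crux's saving. [folklore] -/
theorem T_not_bigO_below_law {σ κ δ C : ℝ} (hκ3 : 3 < κ) (hκ6 : κ < 6) (hκσ : κ < σ)
    (hδ : δ < (6 - κ) / 6) : ¬ ∀ X : ℝ, 1 ≤ X → (windowCount κ σ X : ℝ) ≤ C * X ^ δ := by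
  intro h
  rcases le_or_gt σ 6 with hσ | hσ
  · exact not_windowLaw_le_six hκ3 hκσ hσ hδ h
  · refine not_windowLaw_le_six hκ3 hκ6 le_rfl hδ (fun X hX => le_trans ?_ (h X hX))
    exact_mod_cast windowCount_mono le_rfl hσ.le X

/-- `ModerateWindowCount` with `6 < σ` weakened to `6 ≤ σ`. -/
def ModerateWindowCountFromSix : Prop :=
  ∀ σ : ℝ, 6 ≤ σ → ∃ κ δ C : ℝ, 3 < κ ∧ κ < σ ∧ δ < (σ - κ) / (2 * σ - 6) ∧
    ∀ X : ℝ, 1 ≤ X → (windowCount κ σ X : ℝ) ≤ C * X ^ δ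

/-- `ModerateWindowCount` with `6 < σ` replaced by the bare `3 < σ` (the hypothesis dropped). -/
def ModerateWindowCountWithoutSixLtSigma : Prop :=
  ∀ σ : ℝ, 3 < σ → ∃ κ δ C : ℝ, 3 < κ ∧ κ < σ ∧ δ < (σ - κ) / (2 * σ - 6) ∧
    ∀ X : ℝ, 1 ≤ X → (windowCount κ σ X : ℝ) ≤ C * X ^ δ

/-- **`6 < σ` is sharp**: the `6 ≤ σ` version is FALSE (instance `σ = 6`). [folklore] -/
theorem not_moderateWindowCountFromSix : ¬ ModerateWindowCountFromSix := fun h =>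
  not_moderateWindowLawAtSix (by
    obtain ⟨κ, δ, C, h1, h2, h3, h4⟩ := h 6 le_rfl
    exact ⟨κ, δ, C, h1, h2, h3, h4⟩)

/-- **`6 < σ` is load-bearing**: with the hypothesis dropped the statement is FALSE. [folklore] -/
theorem moderateWindowCount_false_without_sixLtSigma : ¬ ModerateWindowCountWithoutSixLtSigma := fun h =>
  not_moderateWindowLawAtSix (by
    obtain ⟨κ, δ, C, h1, h2, h3, h4⟩ := h 6 (by norm_num)
    exact ⟨κ, δ, C, h1, h2, h3, h4⟩)

end

end Summit.ABC.ABC.Theorems.ModerateWindowCount.Negative
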